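import Summits.AtomisticToContinuum.Crystallization.Theorems.FrustratedLawDichotomyThirdNeighbourNoTwist
import Summits.AtomisticToContinuum.Crystallization.Theorems.FrustratedLawDichotomyScalarBoundsMono
import Summits.AtomisticToContinuum.Crystallization.Theorems.FrustratedLawDichotomyScalarBoundsP

/-!
# FrustratedLawDichotomy · crux `AperiodicFrustratedLawGap` (stmt-AtomisticToContinuum-27623) — `P = CapForcing θ` FROM THE FOUR SCALAR
# BOUNDS THROUGH THE THIRD-NEIGHBOUR EXCLUSION; the `√3` literal lowered to `42/25` (decomp-a2c, prover hand 2, gen 11)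

`FrustratedLawDichotomyScalarBoundsP` (p823696) with the numerical lens hypothesis of the `√3`-bound replaced by the abstract
`ThirdNeighbourExclusion θ D₀` (`FrustratedLawDichotomyThirdNeighbour`): `capForcing_of_exclusion`.  Instances at `θ = 1/100`:

* `capForcing_hundredth_of_scalarBounds₃₃₉` — `D₀ = 339/200` (critic row 465 fall-back F1; crude lens condition, exact arithmetic);
* ★ `capForcing_hundredth_of_scalarBounds₁₆₈` — `D₀ = 42/25 = 1.68` from the SHARP centre-aware lens lemma: P's `√3` certificate becomes
  `LinkPairBound (1/100) (42/25) √3` fcc/hcp, margin `3.5θ` to the census float minimum `1.7146` (was `1.5θ` at `17/10`);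
* by name: `kr2Shape_of_scalarBounds₁₆₈`, `aperiodicFrustratedLawGap_of_scalarBounds₁₆₈` (crux ⟸ `MuEquilibriumDoor ∧ ChargedEnergyGap ∧
  LinkCert(1/100) ∧ LinkPairBound(1/100, 42/25, √3) ×2 ∧ LinkDiagonalBound(1/100, 6/5) ×2 ∧ CappedCert(1/100,1/20) ×2`),
  `noFrustratedPeriodicMinimiser_of_scalarBounds₁₆₈`, and the `339/200` twins;
* `scalarBounds₁₆₈_of_seventeen_tenths` — the registered `17/10` bounds imply the `42/25` bounds (antitone, p823809), so nothing upstream moves.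
`[folklore]` bookkeeping; def-free; no `sorry`; no `instance`/`notation`.
-/

noncomputable section

namespace Summit.AtomisticToContinuum.Crystallization.Theorems.FrustratedLawDichotomyScalarBoundsPSharp

open Literature.Geometry.DiscreteGeometry
open Summit.AtomisticToContinuum.Crystallization.Theses.PricedLinkCensus (ChargedEnergyGap)
open Summit.AtomisticToContinuum.Crystallization.Theorems.FrustratedLawDichotomyTwoShellRigidityCut
  (E3 LinkIso CapForcing KR2Shape kr2Shape_of_cut aperiodicFrustratedLawGap_of_cut noFrustratedPeriodicMinimiser_of_cut)
open Summit.AtomisticToContinuum.Crystallization.Theorems.FrustratedLawDichotomyLinkIsoToolkit (injective_of_linkIso)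
open Summit.AtomisticToContinuum.Crystallization.Theorems.FrustratedLawDichotomyCappedRigidityCert (CappedCert)
open Summit.AtomisticToContinuum.Crystallization.Theorems.FrustratedLawDichotomyCappedRigidityCertPatterns
  (cappedRigidity_of_cert fcc_contactSeparating hcp_contactSeparating)
open Summit.AtomisticToContinuum.Crystallization.Theorems.FrustratedLawDichotomyLinkCert (LinkCert linkClassification_of_linkCert)
open Summit.AtomisticToContinuum.Crystallization.Theorems.FrustratedLawDichotomyCornerPairing
  (exists_partner ncard_common_contacts_eq_of_shared_bond fcc_not_pathType not_pathType_of_fcc_neighbour)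
open Summit.AtomisticToContinuum.Crystallization.Theorems.FrustratedLawDichotomyCornerPairingHalfCap
  (hcp_ncard_common_contacts_of_diagonal exists_halfCap_of_pathType_corner)
open Summit.AtomisticToContinuum.Crystallization.Theorems.FrustratedLawDichotomyHalfCap
  (fcc_ncard_common_contacts_of_diagonal fcc_common_contacts_not_adj hcp_common_contacts_not_adj exists_halfCap_of_diagonal_partners)
open Summit.AtomisticToContinuum.Crystallization.Theorems.FrustratedLawDichotomyNoTwistSwap
  (fcc_exists_diagonal_partner fcc_diagonal_partner_unique hcp_exists_diagonal_partner hcp_pathType_of_two_diagonal_partners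
    linkIso_rebase)
open Summit.AtomisticToContinuum.Crystallization.Theorems.FrustratedLawDichotomyEightCerts (capForcingAt_of_halfCap)
open Summit.AtomisticToContinuum.Crystallization.Theorems.FrustratedLawDichotomyCapMatchOfDiagonal
  (LinkDiagonalBound capMatchCert_of_linkDiagonalBound capMatchCert_of_linkDiagonalBound_hundredth)
open Summit.AtomisticToContinuum.Crystallization.Theorems.FrustratedLawDichotomyNoTwistOfPairBound
  (LinkPairBound fcc_dist_sqrt_three_of_corner hcp_dist_sqrt_three_of_corner)
open Summit.AtomisticToContinuum.Crystallization.Theorems.FrustratedLawDichotomyScalarBoundsP (hcp_degree_sum_one_of_diagonal_of_pathType)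
open Summit.AtomisticToContinuum.Crystallization.Theorems.FrustratedLawDichotomyScalarBoundsMono (linkPairBound_mono_bound)
open Summit.AtomisticToContinuum.Crystallization.Theorems.FrustratedLawDichotomyThirdNeighbour
  (ThirdNeighbourExclusion thirdNeighbourExclusion_hundredth_339_200 thirdNeighbourExclusion_hundredth_42_25
    thirdNeighbourExclusion_hundredth_17_10)
open Summit.AtomisticToContinuum.Crystallization.Theorems.FrustratedLawDichotomyThirdNeighbourNoTwist (noTwist_of_exclusion)

variable {θ : ℝ} {N : ℕ} {y : Fin N → E3} {i : Fin N}

/-! ### §1 Half-caps at every corner from the `√3`-bound and the exclusion -/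

/-- **Half-caps at every corner of an fcc-classified centre from `LinkPairBound θ D₀ √3 fcc` and `ThirdNeighbourExclusion θ D₀`** (p823696's `halfCaps_fcc_of_pairBound`, adapted). [folklore] -/
theorem halfCaps_fcc_of_exclusion {D₀ : ℝ} (hB : LinkPairBound θ D₀ (Real.sqrt 3) fccKissingPattern) (hθ : 0 ≤ θ)
    (hE : ThirdNeighbourExclusion θ D₀) :
    ∀ {N : ℕ} {y : Fin N → E3} {i : Fin N} {τ : ↥fccKissingPattern → Fin N}, Function.Injective y →
      LinkIso θ fccKissingPattern y i τ →
      (∀ j : Fin N, (bondGraph θ y).Adj i j →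
        (∃ τ' : ↥fccKissingPattern → Fin N, LinkIso θ fccKissingPattern y j τ') ∨
          (∃ τ' : ↥hcpKissingPattern → Fin N, LinkIso θ hcpKissingPattern y j τ')) →
      ∀ (w u v : ↥fccKissingPattern), dist (w : E3) (u : E3) = 1 → dist (w : E3) (v : E3) = 1 →
        dist (u : E3) (v : E3) = Real.sqrt 2 →
        ∃ m : Fin N, m ≠ i ∧ (bondGraph θ y).Adj m (τ u) ∧ (bondGraph θ y).Adj m (τ v) ∧ (bondGraph θ y).Adj m (τ w) ∧
          m ∉ Set.range τ := by
  intro N y i τ hy hL hnb w u v hwu hwv huv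
  have hτ : Function.Injective τ := injective_of_linkIso fcc_contactSeparating hL
  have hF2 : ∀ x : ↥fccKissingPattern, dist (w : E3) (x : E3) = 1 → dist (u : E3) (x : E3) = Real.sqrt 2 → x = v :=
    fun x hwx hux => fcc_diagonal_partner_unique w u x v hwu hwx hwv hux huv
  have hS3 : ∀ x : ↥fccKissingPattern, dist (w : E3) (x : E3) = 1 → u ≠ x → dist (u : E3) (x : E3) ≠ 1 →
      dist (u : E3) (x : E3) ≠ Real.sqrt 2 → dist (u : E3) (x : E3) = Real.sqrt 3 :=
    fun x hwx hne h1 h2 => fcc_dist_sqrt_three_of_corner w u x hwu hwx hne h1 h2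
  rcases hnb (τ w) (hL.1 w) with ⟨τ', hL'⟩ | ⟨τ', hL'⟩
  · obtain ⟨w', hw'⟩ := hL'.2.1 i (hL.1 w).symm
    have hτ' : Function.Injective τ' := injective_of_linkIso fcc_contactSeparating hL'
    obtain ⟨a', ha'w, ha', -⟩ := exists_partner hτ' hL w hL' hw' hwu
    obtain ⟨b', hb'w, hb', -⟩ := exists_partner hτ' hL w hL' hw' hwv
    have hdiag : dist (a' : E3) (b' : E3) = Real.sqrt 2 :=
      noTwist_of_exclusion fcc_contactSeparating fcc_contactSeparating hB hθ hE hy hL w hL' hw' hwu ha' hb'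
        (fcc_exists_diagonal_partner w' a' ha'w) hF2 hS3 fcc_ncard_common_contacts_of_diagonal
        (fun u' v' c c' h h1 h2 h3 h4 hne => fcc_common_contacts_not_adj u' v' c c' h h1 h2 h3 h4 hne)
    exact exists_halfCap_of_diagonal_partners hτ' hL w hL' hw' ha'w hb'w ha' hb' hdiag
      (fcc_ncard_common_contacts_of_diagonal a' b' hdiag)
      (fun c c' h1 h2 h3 h4 hne => fcc_common_contacts_not_adj a' b' c c' hdiag h1 h2 h3 h4 hne)
  · obtain ⟨w', hw'⟩ := hL'.2.1 i (hL.1 w).symm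
    have hτ' : Function.Injective τ' := injective_of_linkIso hcp_contactSeparating hL'
    have hLw : LinkIso θ fccKissingPattern y (τ' w') τ := linkIso_rebase hL hw'
    obtain ⟨a', ha'w, ha', -⟩ := exists_partner hτ' hL w hL' hw' hwu
    obtain ⟨b', hb'w, hb', -⟩ := exists_partner hτ' hL w hL' hw' hwv
    -- the neighbour's corner w' is not path-type (a degree-2 contact would transfer to the fcc corner w)
    have hw'np : ¬ ∃ b₀ : ↥hcpKissingPattern, dist (w' : E3) (b₀ : E3) = 1 ∧
        ({c : ↥hcpKissingPattern | dist (w' : E3) (c : E3) = 1} ∩ {c : ↥hcpKissingPattern | dist (b₀ : E3) (c : E3) = 1}).ncard = 2 := by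
      rintro ⟨b₀, hb₀, hdeg2⟩
      obtain ⟨b₁, hb₁w, hb₁, -⟩ := exists_partner hτ hL' w' hLw (w' := w) rfl hb₀
      refine fcc_not_pathType w ⟨b₁, hb₁w, ?_⟩
      rw [← ncard_common_contacts_eq_of_shared_bond hτ' hτ hL' w' hLw (w' := w) rfl hb₁]
      exact hdeg2
    have hdiag : dist (a' : E3) (b' : E3) = Real.sqrt 2 :=
      noTwist_of_exclusion fcc_contactSeparating hcp_contactSeparating hB hθ hE hy hL w hL' hw' hwu ha' hb'
        (hcp_exists_diagonal_partner w' a' hw'np ha'w) hF2 hS3 hcp_ncard_common_contacts_of_diagonal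
        (fun u' v' c c' h h1 h2 h3 h4 hne => hcp_common_contacts_not_adj u' v' c c' h h1 h2 h3 h4 hne)
    exact exists_halfCap_of_diagonal_partners hτ' hL w hL' hw' ha'w hb'w ha' hb' hdiag
      (hcp_ncard_common_contacts_of_diagonal a' b' hdiag)
      (fun c c' h1 h2 h3 h4 hne => hcp_common_contacts_not_adj a' b' c c' hdiag h1 h2 h3 h4 hne)

/-- **Half-caps at every corner of an hcp-classified centre from `LinkPairBound θ D₀ √3 hcp` and the exclusion** (path-type corners combinatorially; p823696 adapted). [folklore] -/
theorem halfCaps_hcp_of_exclusion {D₀ : ℝ} (hB : LinkPairBound θ D₀ (Real.sqrt 3) hcpKissingPattern) (hθ : 0 ≤ θ)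
    (hE : ThirdNeighbourExclusion θ D₀) :
    ∀ {N : ℕ} {y : Fin N → E3} {i : Fin N} {τ : ↥hcpKissingPattern → Fin N}, Function.Injective y →
      LinkIso θ hcpKissingPattern y i τ →
      (∀ j : Fin N, (bondGraph θ y).Adj i j →
        (∃ τ' : ↥fccKissingPattern → Fin N, LinkIso θ fccKissingPattern y j τ') ∨
          (∃ τ' : ↥hcpKissingPattern → Fin N, LinkIso θ hcpKissingPattern y j τ')) →
      ∀ (w u v : ↥hcpKissingPattern), dist (w : E3) (u : E3) = 1 → dist (w : E3) (v : E3) = 1 →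
        dist (u : E3) (v : E3) = Real.sqrt 2 →
        ∃ m : Fin N, m ≠ i ∧ (bondGraph θ y).Adj m (τ u) ∧ (bondGraph θ y).Adj m (τ v) ∧ (bondGraph θ y).Adj m (τ w) ∧
          m ∉ Set.range τ := by
  intro N y i τ hy hL hnb w u v hwu hwv huv
  have hτ : Function.Injective τ := injective_of_linkIso hcp_contactSeparating hL
  have huv_ne : u ≠ v := by
    intro h; rw [h, dist_self] at huv; exact (Real.sqrt_pos.2 (by norm_num : (0 : ℝ) < 2)).ne huv
  by_cases hpt : ∃ b₀ : ↥hcpKissingPattern, dist (w : E3) (b₀ : E3) = 1 ∧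
      ({c : ↥hcpKissingPattern | dist (w : E3) (c : E3) = 1} ∩ {c : ↥hcpKissingPattern | dist (b₀ : E3) (c : E3) = 1}).ncard = 2
  · -- path-type corner: the pairing is crystal combinatorially (CORNER PAIRING I/II)
    have hsum := hcp_degree_sum_one_of_diagonal_of_pathType w hpt u v hwu hwv huv_ne huv
    obtain ⟨b₀, hb₀, hdeg2⟩ := hpt
    rcases hnb (τ w) (hL.1 w) with ⟨τ', hL'⟩ | ⟨τ', hL'⟩
    · obtain ⟨w', hw'⟩ := hL'.2.1 i (hL.1 w).symm
      have hτ' : Function.Injective τ' := injective_of_linkIso fcc_contactSeparating hL'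
      exact absurd (not_pathType_of_fcc_neighbour hτ hτ' hL w hL' hw' hb₀ hdeg2) not_false
    · obtain ⟨w', hw'⟩ := hL'.2.1 i (hL.1 w).symm
      exact exists_halfCap_of_pathType_corner hτ hL w hL' hw' hwu hb₀ hwv huv_ne hdeg2 hsum
  · -- matching-type corner: the √3-bound
    have hF2 : ∀ x : ↥hcpKissingPattern, dist (w : E3) (x : E3) = 1 → dist (u : E3) (x : E3) = Real.sqrt 2 → x = v := by
      intro x hwx hux
      by_contra hxv
      exact hpt (hcp_pathType_of_two_diagonal_partners w u x v hwu hwx hwv hux huv hxv)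
    have hS3 : ∀ x : ↥hcpKissingPattern, dist (w : E3) (x : E3) = 1 → u ≠ x → dist (u : E3) (x : E3) ≠ 1 →
        dist (u : E3) (x : E3) ≠ Real.sqrt 2 → dist (u : E3) (x : E3) = Real.sqrt 3 :=
      fun x hwx hne h1 h2 => hcp_dist_sqrt_three_of_corner w u x hpt hwu hwx hne h1 h2
    rcases hnb (τ w) (hL.1 w) with ⟨τ', hL'⟩ | ⟨τ', hL'⟩
    · obtain ⟨w', hw'⟩ := hL'.2.1 i (hL.1 w).symm
      have hτ' : Function.Injective τ' := injective_of_linkIso fcc_contactSeparating hL'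
      obtain ⟨a', ha'w, ha', -⟩ := exists_partner hτ' hL w hL' hw' hwu
      obtain ⟨b', hb'w, hb', -⟩ := exists_partner hτ' hL w hL' hw' hwv
      have hdiag : dist (a' : E3) (b' : E3) = Real.sqrt 2 :=
        noTwist_of_exclusion hcp_contactSeparating fcc_contactSeparating hB hθ hE hy hL w hL' hw' hwu ha' hb'
          (fcc_exists_diagonal_partner w' a' ha'w) hF2 hS3 fcc_ncard_common_contacts_of_diagonal
          (fun u' v' c c' h h1 h2 h3 h4 hne => fcc_common_contacts_not_adj u' v' c c' h h1 h2 h3 h4 hne)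
      exact exists_halfCap_of_diagonal_partners hτ' hL w hL' hw' ha'w hb'w ha' hb' hdiag
        (fcc_ncard_common_contacts_of_diagonal a' b' hdiag)
        (fun c c' h1 h2 h3 h4 hne => fcc_common_contacts_not_adj a' b' c c' hdiag h1 h2 h3 h4 hne)
    · obtain ⟨w', hw'⟩ := hL'.2.1 i (hL.1 w).symm
      have hτ' : Function.Injective τ' := injective_of_linkIso hcp_contactSeparating hL'
      have hLw : LinkIso θ hcpKissingPattern y (τ' w') τ := linkIso_rebase hL hw'
      obtain ⟨a', ha'w, ha', -⟩ := exists_partner hτ' hL w hL' hw' hwu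
      obtain ⟨b', hb'w, hb', -⟩ := exists_partner hτ' hL w hL' hw' hwv
      have hw'np : ¬ ∃ b₀ : ↥hcpKissingPattern, dist (w' : E3) (b₀ : E3) = 1 ∧
          ({c : ↥hcpKissingPattern | dist (w' : E3) (c : E3) = 1} ∩ {c : ↥hcpKissingPattern | dist (b₀ : E3) (c : E3) = 1}).ncard = 2 := by
        rintro ⟨b₀, hb₀, hdeg2⟩
        obtain ⟨b₁, hb₁w, hb₁, -⟩ := exists_partner hτ hL' w' hLw (w' := w) rfl hb₀
        refine hpt ⟨b₁, hb₁w, ?_⟩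
        rw [← ncard_common_contacts_eq_of_shared_bond hτ' hτ hL' w' hLw (w' := w) rfl hb₁]
        exact hdeg2
      have hdiag : dist (a' : E3) (b' : E3) = Real.sqrt 2 :=
        noTwist_of_exclusion hcp_contactSeparating hcp_contactSeparating hB hθ hE hy hL w hL' hw' hwu ha' hb'
          (hcp_exists_diagonal_partner w' a' hw'np ha'w) hF2 hS3 hcp_ncard_common_contacts_of_diagonal
          (fun u' v' c c' h h1 h2 h3 h4 hne => hcp_common_contacts_not_adj u' v' c c' h h1 h2 h3 h4 hne)
      exact exists_halfCap_of_diagonal_partners hτ' hL w hL' hw' ha'w hb'w ha' hb' hdiag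
        (hcp_ncard_common_contacts_of_diagonal a' b' hdiag)
        (fun c c' h1 h2 h3 h4 hne => hcp_common_contacts_not_adj a' b' c c' hdiag h1 h2 h3 h4 hne)

/-! ### §2 `P` from the four scalar bounds and the exclusion; literals `339/200` and `42/25`; the column by name -/

/-- ★ **`CapForcing θ` from `LinkPairBound θ D₀ √3` ×2, `LinkDiagonalBound θ d₀` ×2, the five-point lens condition for `d₀` and the
third-neighbour exclusion for `D₀`.** [folklore] -/
theorem capForcing_of_exclusion {D₀ d₀ : ℝ} (hθ : 0 ≤ θ) (hd₀ : 0 < d₀) (hE : ThirdNeighbourExclusion θ D₀)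
    (hnum5 : (5 - Real.sqrt 5) / 2 * (((1 + θ) ^ 2) ^ 2 - d₀ ^ 2 / 4) <
      ((1 + θ)⁻¹ ^ 2) ^ 2 - ((((1 + θ) ^ 2) ^ 2 - (1 + θ)⁻¹ ^ 2) / d₀) ^ 2)
    (hBf : LinkPairBound θ D₀ (Real.sqrt 3) fccKissingPattern) (hBh : LinkPairBound θ D₀ (Real.sqrt 3) hcpKissingPattern)
    (hDf : LinkDiagonalBound θ d₀ fccKissingPattern) (hDh : LinkDiagonalBound θ d₀ hcpKissingPattern) : CapForcing θ :=
  ⟨capForcingAt_of_halfCap fcc_contactSeparating fcc_ncard_common_contacts_of_diagonal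
      (capMatchCert_of_linkDiagonalBound hθ hd₀ hnum5 hDf) (halfCaps_fcc_of_exclusion hBf hθ hE),
   capForcingAt_of_halfCap hcp_contactSeparating hcp_ncard_common_contacts_of_diagonal
      (capMatchCert_of_linkDiagonalBound hθ hd₀ hnum5 hDh) (halfCaps_hcp_of_exclusion hBh hθ hE)⟩

/-- **`CapForcing (1/100)` from the `√3`-bounds at `D₀ = 339/200` (critic row 465 fall-back F1) and the diagonal bounds at `6/5`.** [folklore] -/
theorem capForcing_hundredth_of_scalarBounds₃₃₉
    (hBf : LinkPairBound (1 / 100) (339 / 200) (Real.sqrt 3) fccKissingPattern)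
    (hBh : LinkPairBound (1 / 100) (339 / 200) (Real.sqrt 3) hcpKissingPattern)
    (hDf : LinkDiagonalBound (1 / 100) (6 / 5) fccKissingPattern) (hDh : LinkDiagonalBound (1 / 100) (6 / 5) hcpKissingPattern) :
    CapForcing (1 / 100) :=
  ⟨capForcingAt_of_halfCap fcc_contactSeparating fcc_ncard_common_contacts_of_diagonal
      (capMatchCert_of_linkDiagonalBound_hundredth hDf)
      (halfCaps_fcc_of_exclusion hBf (by norm_num) thirdNeighbourExclusion_hundredth_339_200),
   capForcingAt_of_halfCap hcp_contactSeparating hcp_ncard_common_contacts_of_diagonal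
      (capMatchCert_of_linkDiagonalBound_hundredth hDh)
      (halfCaps_hcp_of_exclusion hBh (by norm_num) thirdNeighbourExclusion_hundredth_339_200)⟩

/-- ★ **`CapForcing (1/100)` from the `√3`-bounds at `D₀ = 42/25 = 1.68` (sharp lens) and the diagonal bounds at `6/5`.** [folklore] -/
theorem capForcing_hundredth_of_scalarBounds₁₆₈
    (hBf : LinkPairBound (1 / 100) (42 / 25) (Real.sqrt 3) fccKissingPattern)
    (hBh : LinkPairBound (1 / 100) (42 / 25) (Real.sqrt 3) hcpKissingPattern)
    (hDf : LinkDiagonalBound (1 / 100) (6 / 5) fccKissingPattern) (hDh : LinkDiagonalBound (1 / 100) (6 / 5) hcpKissingPattern) :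
    CapForcing (1 / 100) :=
  ⟨capForcingAt_of_halfCap fcc_contactSeparating fcc_ncard_common_contacts_of_diagonal
      (capMatchCert_of_linkDiagonalBound_hundredth hDf)
      (halfCaps_fcc_of_exclusion hBf (by norm_num) thirdNeighbourExclusion_hundredth_42_25),
   capForcingAt_of_halfCap hcp_contactSeparating hcp_ncard_common_contacts_of_diagonal
      (capMatchCert_of_linkDiagonalBound_hundredth hDh)
      (halfCaps_hcp_of_exclusion hBh (by norm_num) thirdNeighbourExclusion_hundredth_42_25)⟩

/-- **The registered `17/10` bounds imply the `42/25` bounds** (`LinkPairBound` is antitone in the bound, p823809): the old P-side of record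
feeds the new literal; nothing upstream moves. [folklore] -/
theorem scalarBounds₁₆₈_of_seventeen_tenths {Pat : Finset E3} (h : LinkPairBound (1 / 100) (17 / 10) (Real.sqrt 3) Pat) :
    LinkPairBound (1 / 100) (42 / 25) (Real.sqrt 3) Pat :=
  linkPairBound_mono_bound (by norm_num) h

/-- ★ **`KR2Shape` from `LinkCert(1/100)` (G), the four scalar bounds with the `√3` literal `42/25` (P) and `CappedCert(1/100,1/20)` ×2 (M).**
[folklore] -/
theorem kr2Shape_of_scalarBounds₁₆₈ (hG : LinkCert (1 / 100))
    (hBf : LinkPairBound (1 / 100) (42 / 25) (Real.sqrt 3) fccKissingPattern)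
    (hBh : LinkPairBound (1 / 100) (42 / 25) (Real.sqrt 3) hcpKissingPattern)
    (hDf : LinkDiagonalBound (1 / 100) (6 / 5) fccKissingPattern) (hDh : LinkDiagonalBound (1 / 100) (6 / 5) hcpKissingPattern)
    (hMf : CappedCert (1 / 100) (1 / 20) fccKissingPattern) (hMh : CappedCert (1 / 100) (1 / 20) hcpKissingPattern) : KR2Shape :=
  kr2Shape_of_cut (linkClassification_of_linkCert hG) (capForcing_hundredth_of_scalarBounds₁₆₈ hBf hBh hDf hDh)
    (cappedRigidity_of_cert hMf hMh)

/-- **`AperiodicFrustratedLawGap` (crux of item 27623) BY NAME** from `MuEquilibriumDoor ∧ ChargedEnergyGap`, `LinkCert(1/100)`, the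
`√3`-bounds at `42/25`, the diagonal bounds at `6/5` and the two capped certificates. [folklore] -/
theorem aperiodicFrustratedLawGap_of_scalarBounds₁₆₈
    (hDoor : Summit.AtomisticToContinuum.Crystallization.Theses.GrainCoreNetworkSplit.MuEquilibriumDoor) (hgap : ChargedEnergyGap)
    (hG : LinkCert (1 / 100))
    (hBf : LinkPairBound (1 / 100) (42 / 25) (Real.sqrt 3) fccKissingPattern)
    (hBh : LinkPairBound (1 / 100) (42 / 25) (Real.sqrt 3) hcpKissingPattern)
    (hDf : LinkDiagonalBound (1 / 100) (6 / 5) fccKissingPattern) (hDh : LinkDiagonalBound (1 / 100) (6 / 5) hcpKissingPattern)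
    (hMf : CappedCert (1 / 100) (1 / 20) fccKissingPattern) (hMh : CappedCert (1 / 100) (1 / 20) hcpKissingPattern) :
    Summit.AtomisticToContinuum.Crystallization.Theses.FrustratedLawDichotomy.AperiodicFrustratedLawGap :=
  aperiodicFrustratedLawGap_of_cut hDoor hgap (linkClassification_of_linkCert hG)
    (capForcing_hundredth_of_scalarBounds₁₆₈ hBf hBh hDf hDh) (cappedRigidity_of_cert hMf hMh)

/-- **Item 26654 `NoFrustratedPeriodicMinimiser`, door-free, from the same statements (`√3` literal `42/25`).** [folklore] -/
theorem noFrustratedPeriodicMinimiser_of_scalarBounds₁₆₈ (hgap : ChargedEnergyGap) (hG : LinkCert (1 / 100))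
    (hBf : LinkPairBound (1 / 100) (42 / 25) (Real.sqrt 3) fccKissingPattern)
    (hBh : LinkPairBound (1 / 100) (42 / 25) (Real.sqrt 3) hcpKissingPattern)
    (hDf : LinkDiagonalBound (1 / 100) (6 / 5) fccKissingPattern) (hDh : LinkDiagonalBound (1 / 100) (6 / 5) hcpKissingPattern)
    (hMf : CappedCert (1 / 100) (1 / 20) fccKissingPattern) (hMh : CappedCert (1 / 100) (1 / 20) hcpKissingPattern) :
    Summit.AtomisticToContinuum.Crystallization.Theses.PeriodicChargeSplit.NoFrustratedPeriodicMinimiser :=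
  noFrustratedPeriodicMinimiser_of_cut hgap (linkClassification_of_linkCert hG)
    (capForcing_hundredth_of_scalarBounds₁₆₈ hBf hBh hDf hDh) (cappedRigidity_of_cert hMf hMh)

/-- **`KR2Shape` with the `√3` literal `339/200`** (fall-back F1). [folklore] -/
theorem kr2Shape_of_scalarBounds₃₃₉ (hG : LinkCert (1 / 100))
    (hBf : LinkPairBound (1 / 100) (339 / 200) (Real.sqrt 3) fccKissingPattern)
    (hBh : LinkPairBound (1 / 100) (339 / 200) (Real.sqrt 3) hcpKissingPattern)
    (hDf : LinkDiagonalBound (1 / 100) (6 / 5) fccKissingPattern) (hDh : LinkDiagonalBound (1 / 100) (6 / 5) hcpKissingPattern)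
    (hMf : CappedCert (1 / 100) (1 / 20) fccKissingPattern) (hMh : CappedCert (1 / 100) (1 / 20) hcpKissingPattern) : KR2Shape :=
  kr2Shape_of_cut (linkClassification_of_linkCert hG) (capForcing_hundredth_of_scalarBounds₃₃₉ hBf hBh hDf hDh)
    (cappedRigidity_of_cert hMf hMh)

/-- **`AperiodicFrustratedLawGap` BY NAME with the `√3` literal `339/200`** (fall-back F1). [folklore] -/
theorem aperiodicFrustratedLawGap_of_scalarBounds₃₃₉
    (hDoor : Summit.AtomisticToContinuum.Crystallization.Theses.GrainCoreNetworkSplit.MuEquilibriumDoor) (hgap : ChargedEnergyGap)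
    (hG : LinkCert (1 / 100))
    (hBf : LinkPairBound (1 / 100) (339 / 200) (Real.sqrt 3) fccKissingPattern)
    (hBh : LinkPairBound (1 / 100) (339 / 200) (Real.sqrt 3) hcpKissingPattern)
    (hDf : LinkDiagonalBound (1 / 100) (6 / 5) fccKissingPattern) (hDh : LinkDiagonalBound (1 / 100) (6 / 5) hcpKissingPattern)
    (hMf : CappedCert (1 / 100) (1 / 20) fccKissingPattern) (hMh : CappedCert (1 / 100) (1 / 20) hcpKissingPattern) :
    Summit.AtomisticToContinuum.Crystallization.Theses.FrustratedLawDichotomy.AperiodicFrustratedLawGap :=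
  aperiodicFrustratedLawGap_of_cut hDoor hgap (linkClassification_of_linkCert hG)
    (capForcing_hundredth_of_scalarBounds₃₃₉ hBf hBh hDf hDh) (cappedRigidity_of_cert hMf hMh)

/-- **Item 26654 with the `√3` literal `339/200`** (fall-back F1). [folklore] -/
theorem noFrustratedPeriodicMinimiser_of_scalarBounds₃₃₉ (hgap : ChargedEnergyGap) (hG : LinkCert (1 / 100))
    (hBf : LinkPairBound (1 / 100) (339 / 200) (Real.sqrt 3) fccKissingPattern)
    (hBh : LinkPairBound (1 / 100) (339 / 200) (Real.sqrt 3) hcpKissingPattern)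
    (hDf : LinkDiagonalBound (1 / 100) (6 / 5) fccKissingPattern) (hDh : LinkDiagonalBound (1 / 100) (6 / 5) hcpKissingPattern)
    (hMf : CappedCert (1 / 100) (1 / 20) fccKissingPattern) (hMh : CappedCert (1 / 100) (1 / 20) hcpKissingPattern) :
    Summit.AtomisticToContinuum.Crystallization.Theses.PeriodicChargeSplit.NoFrustratedPeriodicMinimiser :=
  noFrustratedPeriodicMinimiser_of_cut hgap (linkClassification_of_linkCert hG)
    (capForcing_hundredth_of_scalarBounds₃₃₉ hBf hBh hDf hDh) (cappedRigidity_of_cert hMf hMh)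

end Summit.AtomisticToContinuum.Crystallization.Theorems.FrustratedLawDichotomyScalarBoundsPSharp

end
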